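import Literature.AlgebraicGeometry.Frobenioids.CosetBaseEquivalenceConj
import HarnessLib

/-!
# Equivalences of small coset categories are isomorphic iff their induced group isomorphisms differ by an inner
# automorphism (`E ≅ 𝟭 ↔` the induced `φ` is inner)

Mochizuki, *The geometry of Frobenioids II*, Kyushu J. Math. **62** (2008), §2, proof of Theorem 2.4 (ii), author's
text p. 21 [cite: MochizukiFrdII2008, Thm 2.4 (ii) p.21] ("`Ψ` induces … `G₁ ⥲ G₂` … well-defined up to composition with
automorphisms … induced by elements of `G₂`"); Mochizuki, *Semi-graphs of anabelioids*, Publ. RIMS **42** (2006),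
Rmk. 3.2.1 p. 35 [cite: MochizukiSemiAnbd2006, Rmk 3.2.1 p.35]; consumed by Mochizuki, *Inter-universal Teichmüller
theory I*, proof of Cor. 5.3 (iv) [the `Ker(Aut(ℱ_v) → Aut(𝒟_v))` injectivity step], p. 144 l. 41–42
[cite: Mochizuki2012, I Cor 5.3 (iv) p.144] ("we suppose [without loss of generality] that `α` lies over the identity
self-equivalence of `𝒟_v`"; the hub-row label «C53ii/N2» below names the cell's Cor. 5.3 (ii) sub-DAG row, not the print
item quoted): the dictionary «isomorphism classes of
equivalences `𝓑^temp(Π₁)⁰ ⥲ 𝓑^temp(Π₂)⁰`» ↪ «outer isomorphisms `Π₁ ⥲ Π₂`».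

PROOF-ONLY sequel (cell abc-iut, [IUTchI] Cor. 5.3 (ii) hub row «C53ii/N2 COSETCAT-SELFEQUIV-INN» of abc-iut-L5-t4's
`SUBDAG-IUTchI-Cor53.md` §R; part 2 of 2) to `CosetBaseEquivalenceConj.lean` (part 1: levelwise straightenings with group
maps; `F ≅ F'` ⇒ `φ' = Inn(h⁻¹) ∘ φ`).  The tree had «equivalence ⇒ `φ`» (abc-iut-L1
`exists_mulEquiv_compatible_of_cosetCat_equivalence`) and «`φ` ⇒ equivalence»
(`CosetCat.nonempty_equivalence_of_continuousMulEquiv`); with part 1 this file completes INJECTIVITY MODULO INNER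
AUTOMORPHISMS:

* §3 **`φ' = Inn(h⁻¹) ∘ φ` ⇒ `F ≅ F'`** (`nonempty_iso_of_conj`): for FAITHFUL `F, F'` with levelwise straightenings of
  a cofinal tower and SURJECTIVE group maps `φ, φ'`, the isomorphisms `F(Π₁/N_k) ≅ Π₂/N₂,k —r_h→ Π₂/N₂,k ≅ F'(Π₁/N_k)`
  descend along `F` of any `Π₁/N_k → X` (`exists_desc_crightMul`; the descent equation is independent of the level and
  of the chosen map, `desc_eq_of_desc_eq`) to a natural isomorphism — every arrow of `CosetCat` is an epimorphism;
* §4 for EQUIVALENCES, with data in the exact output format of `exists_mulEquiv_compatible_of_cosetCat_equivalence`: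
  `nonempty_iso_functor_iff_exists_conj` (**`E ≅ E'` as functors `↔ φ' = Inn ∘ φ`**) and, for a self-equivalence,
  `nonempty_iso_id_iff_exists_conj` (**`E.functor ≅ 𝟭 ↔` the induced `φ` is inner**).
Theorems only (no definitions, no instances); pure category / topological-group theory over landed files; nothing of the
disputed series is asserted and nothing here bears on [IUTchIII] Cor. 3.12.
-/

noncomputable section

namespace Literature.AlgebraicGeometry.Frobenioids

open CategoryTheory Opposite Topology Filter
open Literature.AnabelianGeometry.SemiGraphs

universe u

namespace BaseGaloisSystem

section ConjHelper

variable {G : Type u} [Group G] [TopologicalSpace G]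

/-- Membership in an open normal subgroup is invariant under conjugation: `h⁻¹ x h ∈ M ↔ x ∈ M` (private plumbing).
[folklore] -/
private theorem inv_mul_mul_mem_iff (M : OpenNormalSubgroup G) (h x : G) : h⁻¹ * x * h ∈ M ↔ x ∈ M := by
  constructor
  · intro hx
    have h2 : h * (h⁻¹ * x * h) * h⁻¹ = x := by
      rw [← mul_assoc, ← mul_assoc, mul_inv_cancel, one_mul, mul_inv_cancel_right]
    have h3 := M.isNormal'.conj_mem (h⁻¹ * x * h) hx h
    rw [h2] at h3
    exact h3
  · intro hx
    exact M.isNormal'.conj_mem' x hx h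

end ConjHelper

/-! ### §3 Group maps differing by an inner automorphism give isomorphic functors -/

section InnerToIso

variable {G : Type u} [Group G] [TopologicalSpace G] {G₂ : Type u} [Group G₂] [TopologicalSpace G₂]
  (N : ℕ → OpenNormalSubgroup G) (hN : Antitone N)
  {F F' : CosetCat G ⥤ CosetCat G₂} {N₂ : ℕ → OpenNormalSubgroup G₂} {hN₂ : Antitone N₂}
  (j : ∀ k : ℕ, cQ (N₂ k) ≅ F.obj (cQ (N k))) {φ : G → G₂}
  (hφ : ∀ (k : ℕ) (g : G), crightMul (N₂ k) (φ g) ≫ (j k).hom = (j k).hom ≫ F.map (crightMul (N k) g))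
  (j' : ∀ k : ℕ, cQ (N₂ k) ≅ F'.obj (cQ (N k))) {φ' : G → G₂}
  (hφ' : ∀ (k : ℕ) (g : G), crightMul (N₂ k) (φ' g) ≫ (j' k).hom = (j' k).hom ≫ F'.map (crightMul (N k) g))
  {h : G₂} (hh : ∀ g : G, φ g * h = h * φ' g)

include hφ hφ' hh in
/-- **Descent of `r_h` along `F(Π₁/N_k → X)`.**  For `F` faithful with SURJECTIVE group map `φ`, `φ·h = h·φ'`, and any
`p : Π₁/N_k → X`, the morphism `Π₂/N₂,k —r_h→ Π₂/N₂,k ≅ F'(Π₁/N_k) → F'(X)` factors through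
`Π₂/N₂,k ≅ F(Π₁/N_k) → F(X)`: an element of the stabiliser of the latter's point is `φ g` with `r_g ≫ p = p`, and then
`r_{φ g} ≫ r_h ≫ j'_k ≫ F'(p) = r_h ≫ j'_k ≫ F'(r_g ≫ p)`. [cite: MochizukiFrdII2008, Thm 2.4 (ii) p.21] -/
theorem exists_desc_crightMul [F.Faithful] (hsφ : Function.Surjective φ) {X : CosetCat G} {k : ℕ}
    (p : cQ (N k) ⟶ X) :
    ∃ t : F.obj X ⟶ F'.obj X, (j k).hom ≫ F.map p ≫ t = crightMul (N₂ k) h ≫ (j' k).hom ≫ F'.map p := by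
  have hside : ∀ a : G₂, a • CosetCat.pt ((j k).hom ≫ F.map p) = CosetCat.pt ((j k).hom ≫ F.map p) →
      a • CosetCat.pt (crightMul (N₂ k) h ≫ (j' k).hom ≫ F'.map p) =
        CosetCat.pt (crightMul (N₂ k) h ≫ (j' k).hom ≫ F'.map p) := by
    intro a ha
    obtain ⟨g, rfl⟩ := hsφ a
    rw [← crightMul_comp_eq_self_iff_smul] at ha ⊢
    have hg : crightMul (N k) g ≫ p = p := by
      rw [← Category.assoc, hφ, Category.assoc, ← F.map_comp] at ha
      exact F.map_injective ((cancel_epi (j k).hom).1 ha)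
    rw [← Category.assoc, crightMul_comp, hh, ← crightMul_comp, Category.assoc,
      ← Category.assoc (crightMul (N₂ k) (φ' g)), hφ', Category.assoc, ← F'.map_comp, hg]
  obtain ⟨t, ht⟩ := exists_desc_of_smul_pt ((j k).hom ≫ F.map p) (crightMul (N₂ k) h ≫ (j' k).hom ≫ F'.map p)
    hside
  refine ⟨t, ?_⟩
  rw [Category.assoc] at ht
  exact ht

include hφ hφ' hh in
/-- The descent equation is stable under right translation of `p` (same level). [cite: MochizukiFrdII2008, Thm 2.4 (ii) p.21] -/
theorem desc_eq_comp_crightMul {X : CosetCat G} {k : ℕ} (p : cQ (N k) ⟶ X) (a : G) (t : F.obj X ⟶ F'.obj X)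
    (ht : (j k).hom ≫ F.map p ≫ t = crightMul (N₂ k) h ≫ (j' k).hom ≫ F'.map p) :
    (j k).hom ≫ F.map (crightMul (N k) a ≫ p) ≫ t = crightMul (N₂ k) h ≫ (j' k).hom ≫ F'.map (crightMul (N k) a ≫ p) := by
  rw [F.map_comp, Category.assoc, ← Category.assoc (j k).hom, ← hφ, Category.assoc, ht, F'.map_comp,
    ← Category.assoc (j' k).hom, ← hφ']
  simp only [Category.assoc]
  rw [← Category.assoc, crightMul_comp, hh, ← crightMul_comp, Category.assoc]

/-- The descent equation moves up and down the tower along the projections (every projection is an epimorphism).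
[cite: MochizukiFrdII2008, Thm 2.4 (ii) p.21] -/
theorem desc_eq_iff_of_cproj
    (hjp : ∀ ⦃i k : ℕ⦄ (hik : i ≤ k), (j k).hom ≫ F.map (cproj (hN hik)) = cproj (hN₂ hik) ≫ (j i).hom)
    (hjp' : ∀ ⦃i k : ℕ⦄ (hik : i ≤ k), (j' k).hom ≫ F'.map (cproj (hN hik)) = cproj (hN₂ hik) ≫ (j' i).hom)
    {X : CosetCat G} {i k : ℕ} (hik : i ≤ k) (p : cQ (N i) ⟶ X) (t : F.obj X ⟶ F'.obj X) :
    (j k).hom ≫ F.map (cproj (hN hik) ≫ p) ≫ t = crightMul (N₂ k) h ≫ (j' k).hom ≫ F'.map (cproj (hN hik) ≫ p) ↔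
      (j i).hom ≫ F.map p ≫ t = crightMul (N₂ i) h ≫ (j' i).hom ≫ F'.map p := by
  haveI : Epi (cproj (hN₂ hik)) := CosetCat.isTotallyEpimorphic.epi _
  rw [F.map_comp, F'.map_comp, Category.assoc, ← Category.assoc (j k).hom, hjp hik,
    ← Category.assoc (j' k).hom, hjp' hik, Category.assoc, Category.assoc,
    ← Category.assoc (crightMul (N₂ k) h), crightMul_cproj, Category.assoc]
  constructor
  · intro H
    exact (cancel_epi (cproj (hN₂ hik))).1 H
  · intro H
    rw [H]

include hφ hφ' hh in
/-- **The descent equation at one `(k₀, p₀)` implies it at every `(k, p)`** (common refinement of the levels, torsor of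
maps out of a Galois object, stability under translation). [cite: MochizukiFrdII2008, Thm 2.4 (ii) p.21] -/
theorem desc_eq_of_desc_eq
    (hjp : ∀ ⦃i k : ℕ⦄ (hik : i ≤ k), (j k).hom ≫ F.map (cproj (hN hik)) = cproj (hN₂ hik) ≫ (j i).hom)
    (hjp' : ∀ ⦃i k : ℕ⦄ (hik : i ≤ k), (j' k).hom ≫ F'.map (cproj (hN hik)) = cproj (hN₂ hik) ≫ (j' i).hom)
    {X : CosetCat G} {k₀ : ℕ} (p₀ : cQ (N k₀) ⟶ X) (t : F.obj X ⟶ F'.obj X)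
    (ht : (j k₀).hom ≫ F.map p₀ ≫ t = crightMul (N₂ k₀) h ≫ (j' k₀).hom ≫ F'.map p₀)
    {k : ℕ} (p : cQ (N k) ⟶ X) :
    (j k).hom ≫ F.map p ≫ t = crightMul (N₂ k) h ≫ (j' k).hom ≫ F'.map p := by
  have h₀ : k₀ ≤ max k₀ k := le_max_left _ _
  have hk : k ≤ max k₀ k := le_max_right _ _
  have e1 := (desc_eq_iff_of_cproj N hN j j' hjp hjp' h₀ p₀ t).2 ht
  obtain ⟨a, ha⟩ := exists_eq_crightMul_comp (N (max k₀ k)) (cproj (hN h₀) ≫ p₀) (cproj (hN hk) ≫ p)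
  have e2 := desc_eq_comp_crightMul N j hφ j' hφ' hh (cproj (hN h₀) ≫ p₀) a t e1
  rw [← ha] at e2
  exact (desc_eq_iff_of_cproj N hN j j' hjp hjp' hk p t).1 e2

end InnerToIso

section InnerToIsoMain

variable {G : Type u} [Group G] [TopologicalSpace G] {G₂ : Type u} [Group G₂] [TopologicalSpace G₂]
  (N : ℕ → OpenNormalSubgroup G) (hN : Antitone N)

/-- **`φ' = Inn(h⁻¹) ∘ φ` ⇒ `F ≅ F'`, same tower.**  For FAITHFUL `F, F' : CosetCat Π₁ ⥤ CosetCat Π₂` with levelwise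
straightenings onto the same tower `(Π₂/N₂,k)_k` of a cofinal `(Π₁/N_k)_k` and SURJECTIVE group maps `φ`, `φ'`
satisfying `φ' g = h⁻¹ φ(g) h`: `F ≅ F'`.  Components: the descent of `F(Π₁/N_k) ≅ Π₂/N₂,k —r_h→ Π₂/N₂,k ≅ F'(Π₁/N_k)`
along `F(Π₁/N_k → X)`; inverse from `h⁻¹` with the roles swapped; naturality because every arrow of `CosetCat` is an
epimorphism. [cite: MochizukiFrdII2008, Thm 2.4 (ii) p.21] -/
theorem nonempty_iso_of_conj_of_eq {F F' : CosetCat G ⥤ CosetCat G₂} [F.Faithful] [F'.Faithful]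
    (hNb : ∀ U ∈ 𝓝 (1 : G), ∃ k, (N k : Set G) ⊆ U)
    {N₂ : ℕ → OpenNormalSubgroup G₂} {hN₂ : Antitone N₂}
    (j : ∀ k : ℕ, cQ (N₂ k) ≅ F.obj (cQ (N k)))
    (hjp : ∀ ⦃i k : ℕ⦄ (hik : i ≤ k), (j k).hom ≫ F.map (cproj (hN hik)) = cproj (hN₂ hik) ≫ (j i).hom)
    {φ : G → G₂} (hsφ : Function.Surjective φ)
    (hφ : ∀ (k : ℕ) (g : G), crightMul (N₂ k) (φ g) ≫ (j k).hom = (j k).hom ≫ F.map (crightMul (N k) g))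
    (j' : ∀ k : ℕ, cQ (N₂ k) ≅ F'.obj (cQ (N k)))
    (hjp' : ∀ ⦃i k : ℕ⦄ (hik : i ≤ k), (j' k).hom ≫ F'.map (cproj (hN hik)) = cproj (hN₂ hik) ≫ (j' i).hom)
    {φ' : G → G₂} (hsφ' : Function.Surjective φ')
    (hφ' : ∀ (k : ℕ) (g : G), crightMul (N₂ k) (φ' g) ≫ (j' k).hom = (j' k).hom ≫ F'.map (crightMul (N k) g))
    {h : G₂} (hh : ∀ g : G, φ' g = h⁻¹ * φ g * h) : Nonempty (F ≅ F') := by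
  have hh1 : ∀ g : G, φ g * h = h * φ' g := fun g => by
    rw [hh, ← mul_assoc, ← mul_assoc, mul_inv_cancel, one_mul]
  have hh2 : ∀ g : G, φ' g * h⁻¹ = h⁻¹ * φ g := fun g => by
    rw [hh, mul_assoc, mul_inv_cancel, mul_one]
  -- a projection `Π₁/N_{k_X} → X` onto every object
  have hex : ∀ X : CosetCat G, ∃ k, (N k : Set G) ⊆ X.sg := fun X => hNb _ X.sg.mem_nhds_one
  choose kX hkX using hex
  let pX : ∀ X : CosetCat G, cQ (N (kX X)) ⟶ X := fun X =>
    CosetCat.homMk ((1 : G) : X.carrier) fun u hu => (CosetCat.smul_one_eq_one_iff X u).mpr (hkX X hu)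
  -- the components and their inverses
  have et := fun X : CosetCat G => exists_desc_crightMul N j hφ j' hφ' hh1 hsφ (pX X)
  have et' := fun X : CosetCat G => exists_desc_crightMul N j' hφ' j hφ hh2 hsφ' (pX X)
  choose t ht using et
  choose t' ht' using et'
  have epiA : ∀ X : CosetCat G, Epi ((j (kX X)).hom ≫ F.map (pX X)) := fun X =>
    CosetCat.isTotallyEpimorphic.epi _
  have epiA' : ∀ X : CosetCat G, Epi ((j' (kX X)).hom ≫ F'.map (pX X)) := fun X =>
    CosetCat.isTotallyEpimorphic.epi _
  have hinv₁ : ∀ X : CosetCat G, t X ≫ t' X = 𝟙 _ := fun X => by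
    haveI := epiA X
    refine (cancel_epi ((j (kX X)).hom ≫ F.map (pX X))).1 ?_
    calc ((j (kX X)).hom ≫ F.map (pX X)) ≫ t X ≫ t' X
        = ((j (kX X)).hom ≫ F.map (pX X) ≫ t X) ≫ t' X := by simp only [Category.assoc]
      _ = (crightMul (N₂ (kX X)) h ≫ (j' (kX X)).hom ≫ F'.map (pX X)) ≫ t' X := by rw [ht X]
      _ = crightMul (N₂ (kX X)) h ≫ ((j' (kX X)).hom ≫ F'.map (pX X) ≫ t' X) := by simp only [Category.assoc]
      _ = crightMul (N₂ (kX X)) h ≫ crightMul (N₂ (kX X)) h⁻¹ ≫ (j (kX X)).hom ≫ F.map (pX X) := by rw [ht' X]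
      _ = ((j (kX X)).hom ≫ F.map (pX X)) ≫ 𝟙 _ := by
          rw [Category.comp_id, ← Category.assoc, crightMul_comp, mul_inv_cancel, crightMul_one, Category.id_comp]
  have hinv₂ : ∀ X : CosetCat G, t' X ≫ t X = 𝟙 _ := fun X => by
    haveI := epiA' X
    refine (cancel_epi ((j' (kX X)).hom ≫ F'.map (pX X))).1 ?_
    calc ((j' (kX X)).hom ≫ F'.map (pX X)) ≫ t' X ≫ t X
        = ((j' (kX X)).hom ≫ F'.map (pX X) ≫ t' X) ≫ t X := by simp only [Category.assoc]
      _ = (crightMul (N₂ (kX X)) h⁻¹ ≫ (j (kX X)).hom ≫ F.map (pX X)) ≫ t X := by rw [ht' X]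
      _ = crightMul (N₂ (kX X)) h⁻¹ ≫ ((j (kX X)).hom ≫ F.map (pX X) ≫ t X) := by simp only [Category.assoc]
      _ = crightMul (N₂ (kX X)) h⁻¹ ≫ crightMul (N₂ (kX X)) h ≫ (j' (kX X)).hom ≫ F'.map (pX X) := by rw [ht X]
      _ = ((j' (kX X)).hom ≫ F'.map (pX X)) ≫ 𝟙 _ := by
          rw [Category.comp_id, ← Category.assoc, crightMul_comp, inv_mul_cancel, crightMul_one, Category.id_comp]
  refine ⟨NatIso.ofComponents (fun X => ⟨t X, t' X, hinv₁ X, hinv₂ X⟩) (fun {X Y} u => ?_)⟩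
  -- naturality: test against the epimorphism `Π₂/N₂,k ≅ F(Π₁/N_k) → F(X)`
  haveI := epiA X
  refine (cancel_epi ((j (kX X)).hom ≫ F.map (pX X))).1 ?_
  have key := desc_eq_of_desc_eq N hN j hφ j' hφ' hh1 hjp hjp' (pX Y) (t Y) (ht Y) (pX X ≫ u)
  rw [F.map_comp, F'.map_comp] at key
  simp only [Category.assoc] at key ⊢
  change (j (kX X)).hom ≫ F.map (pX X) ≫ F.map u ≫ t Y = (j (kX X)).hom ≫ F.map (pX X) ≫ t X ≫ F'.map u
  rw [key, reassoc_of% (ht X)]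

/-- **`φ' = Inn(h⁻¹) ∘ φ` ⇒ `F ≅ F'`.**  For FAITHFUL `F, F' : CosetCat Π₁ ⥤ CosetCat Π₂` with levelwise
straightenings `j : Π₂/N₂,k ≅ F(Π₁/N_k)`, `j' : Π₂/N₂',k ≅ F'(Π₁/N_k)` of a cofinal tower `(N_k)` and SURJECTIVE group
maps `φ`, `φ'`: if `φ' g = h⁻¹ φ(g) h` for all `g`, then the towers coincide (`N₂,k = φ(N_k)`, `N₂',k = φ'(N_k)`) and
`F ≅ F'`. [cite: MochizukiFrdII2008, Thm 2.4 (ii) p.21] -/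
theorem nonempty_iso_of_conj {F F' : CosetCat G ⥤ CosetCat G₂} [F.Faithful] [F'.Faithful]
    (hNb : ∀ U ∈ 𝓝 (1 : G), ∃ k, (N k : Set G) ⊆ U)
    {N₂ : ℕ → OpenNormalSubgroup G₂} {hN₂ : Antitone N₂}
    (j : ∀ k : ℕ, cQ (N₂ k) ≅ F.obj (cQ (N k)))
    (hjp : ∀ ⦃i k : ℕ⦄ (hik : i ≤ k), (j k).hom ≫ F.map (cproj (hN hik)) = cproj (hN₂ hik) ≫ (j i).hom)
    {φ : G → G₂} (hsφ : Function.Surjective φ)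
    (hφ : ∀ (k : ℕ) (g : G), crightMul (N₂ k) (φ g) ≫ (j k).hom = (j k).hom ≫ F.map (crightMul (N k) g))
    {N₂' : ℕ → OpenNormalSubgroup G₂} {hN₂' : Antitone N₂'}
    (j' : ∀ k : ℕ, cQ (N₂' k) ≅ F'.obj (cQ (N k)))
    (hjp' : ∀ ⦃i k : ℕ⦄ (hik : i ≤ k), (j' k).hom ≫ F'.map (cproj (hN hik)) = cproj (hN₂' hik) ≫ (j' i).hom)
    {φ' : G → G₂} (hsφ' : Function.Surjective φ')
    (hφ' : ∀ (k : ℕ) (g : G), crightMul (N₂' k) (φ' g) ≫ (j' k).hom = (j' k).hom ≫ F'.map (crightMul (N k) g))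
    {h : G₂} (hh : ∀ g : G, φ' g = h⁻¹ * φ g * h) : Nonempty (F ≅ F') := by
  have hNN : N₂ = N₂' := funext fun k => SetLike.ext fun x => by
    obtain ⟨g, rfl⟩ := hsφ' x
    rw [apply_mem_iff_mem_of_levelwise N N₂' j' φ' hφ' k g, hh g, inv_mul_mul_mem_iff,
      apply_mem_iff_mem_of_levelwise N N₂ j φ hφ k g]
  subst hNN
  exact nonempty_iso_of_conj_of_eq N hN hNb j hjp hsφ hφ j' hjp' hsφ' hφ' hh

end InnerToIsoMain

/-! ### §4 For equivalences: `E ≅ E' ↔ φ' = Inn ∘ φ`; `E ≅ 𝟭 ↔ φ` inner -/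

section Equivalences

variable {G : Type u} [Group G] [TopologicalSpace G] {G₂ : Type u} [Group G₂] [TopologicalSpace G₂]
  (N : ℕ → OpenNormalSubgroup G) (hN : Antitone N)

/-- **Equivalences of small coset categories are isomorphic iff their induced isomorphisms of groups differ by an inner
automorphism.**  For `Π₂` tempered, a cofinal tower `(Π₁/N_k)_k`, equivalences `E, E' : CosetCat Π₁ ≌ CosetCat Π₂` with
data `(N₂, ι, φ)`, `(N₂', ι', φ')` in the format of `exists_mulEquiv_compatible_of_cosetCat_equivalence` (the first
tower cofinal): `E ≅ E'` as functors `↔ φ' g = h⁻¹ φ(g) h` for one `h ∈ Π₂` — "well-defined up to composition with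
automorphisms … induced by elements of `G₂`"; isomorphism classes of equivalences `𝓑^temp(Π₁)⁰ ⥲ 𝓑^temp(Π₂)⁰` embed
into outer isomorphisms `Π₁ ⥲ Π₂`. [cite: MochizukiFrdII2008, Thm 2.4 (ii) p.21] -/
theorem nonempty_iso_functor_iff_exists_conj (hG₂ : IsTempered G₂)
    (hNb : ∀ U ∈ 𝓝 (1 : G), ∃ k, (N k : Set G) ⊆ U) (E E' : CosetCat G ≌ CosetCat G₂)
    {N₂ : ℕ → OpenNormalSubgroup G₂} {hN₂ : Antitone N₂} (hN₂b : ∀ U ∈ 𝓝 (1 : G₂), ∃ k, (N₂ k : Set G₂) ⊆ U)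
    (ι : cosetSystem N hN ⋙ E.functor.op ≅ cosetSystem N₂ hN₂) (φ : G ≃* G₂)
    (hφ : ∀ g : G, toAutCoset N₂ hN₂ (φ g) =
      ι.conjAut ((Equivalence.congrRight (E := ℕ) E.op).functor.mapIso (toAutCoset N hN g)))
    {N₂' : ℕ → OpenNormalSubgroup G₂} {hN₂' : Antitone N₂'}
    (ι' : cosetSystem N hN ⋙ E'.functor.op ≅ cosetSystem N₂' hN₂') (φ' : G ≃* G₂)
    (hφ' : ∀ g : G, toAutCoset N₂' hN₂' (φ' g) =
      ι'.conjAut ((Equivalence.congrRight (E := ℕ) E'.op).functor.mapIso (toAutCoset N hN g))) :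
    Nonempty (E.functor ≅ E'.functor) ↔ ∃ h : G₂, ∀ g : G, φ' g = h⁻¹ * φ g * h := by
  obtain ⟨j, hjp, c⟩ := exists_levelwise_of_compatible_equivalence N hN N₂ hN₂ E ι φ hφ
  obtain ⟨j', hjp', c'⟩ := exists_levelwise_of_compatible_equivalence N hN N₂' hN₂' E' ι' φ' hφ'
  constructor
  · rintro ⟨θ⟩
    exact exists_conj_of_iso hG₂ N hN θ hN₂b j hjp φ c j' hjp' φ' c'
  · rintro ⟨h, hh⟩
    exact nonempty_iso_of_conj N hN hNb j hjp φ.surjective c j' hjp' φ'.surjective c' hh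

/-- **A self-equivalence of `CosetCat Π` is isomorphic to the identity iff its induced automorphism of `Π` is inner**
(`Π` tempered; `(N, N₂, ι, φ)` any output data of `exists_mulEquiv_compatible_of_cosetCat_equivalence` for `E`, cofinal
towers) — [IUTchI] Cor. 5.3 (iv), proof, p. 144 l. 41–42, "we suppose [without loss of generality] that `α` lies over
the identity self-equivalence of `𝒟_v`": an autoequivalence of `𝒟_v = 𝓑^temp(Π_v)⁰` inducing an inner automorphism of
`Π_v` IS (isomorphic to) the identity. [cite: Mochizuki2012, I Cor 5.3 (iv) p.144] -/
theorem nonempty_iso_id_iff_exists_conj (hG : IsTempered G)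
    (hNb : ∀ U ∈ 𝓝 (1 : G), ∃ k, (N k : Set G) ⊆ U) (E : CosetCat G ≌ CosetCat G)
    {N₂ : ℕ → OpenNormalSubgroup G} {hN₂ : Antitone N₂} (hN₂b : ∀ U ∈ 𝓝 (1 : G), ∃ k, (N₂ k : Set G) ⊆ U)
    (ι : cosetSystem N hN ⋙ E.functor.op ≅ cosetSystem N₂ hN₂) (φ : G ≃* G)
    (hφ : ∀ g : G, toAutCoset N₂ hN₂ (φ g) =
      ι.conjAut ((Equivalence.congrRight (E := ℕ) E.op).functor.mapIso (toAutCoset N hN g))) :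
    Nonempty (E.functor ≅ 𝟭 (CosetCat G)) ↔ ∃ h : G, ∀ g : G, φ g = h * g * h⁻¹ := by
  obtain ⟨j, hjp, c⟩ := exists_levelwise_of_compatible_equivalence N hN N₂ hN₂ E ι φ hφ
  -- the identity functor with the tautological levelwise straightening and group map `id`
  let j₀ : ∀ k : ℕ, cQ (N k) ≅ (𝟭 (CosetCat G)).obj (cQ (N k)) := fun k => Iso.refl _
  have hjp₀ : ∀ ⦃i k : ℕ⦄ (hik : i ≤ k),
      (j₀ k).hom ≫ (𝟭 (CosetCat G)).map (cproj (hN hik)) = cproj (hN hik) ≫ (j₀ i).hom := fun i k hik => by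
    change 𝟙 _ ≫ cproj (hN hik) = cproj (hN hik) ≫ 𝟙 _
    rw [Category.comp_id, Category.id_comp]
  have c₀ : ∀ (k : ℕ) (g : G), crightMul (N k) (id g) ≫ (j₀ k).hom =
      (j₀ k).hom ≫ (𝟭 (CosetCat G)).map (crightMul (N k) g) := fun k g => by
    change crightMul (N k) g ≫ 𝟙 _ = 𝟙 _ ≫ crightMul (N k) g
    rw [Category.comp_id, Category.id_comp]
  constructor
  · rintro ⟨θ⟩
    obtain ⟨h, hh⟩ := exists_conj_of_iso hG N hN θ hN₂b j hjp φ c j₀ hjp₀ id c₀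
    refine ⟨h, fun g => ?_⟩
    have e : g = h⁻¹ * φ g * h := hh g
    calc φ g = h * (h⁻¹ * φ g * h) * h⁻¹ := by
          rw [← mul_assoc, ← mul_assoc, mul_inv_cancel, one_mul, mul_inv_cancel_right]
      _ = h * g * h⁻¹ := by rw [← e]
  · rintro ⟨h, hh⟩
    refine nonempty_iso_of_conj N hN hNb j hjp φ.surjective c j₀ hjp₀ Function.surjective_id c₀ (h := h)
      fun g => ?_
    change g = h⁻¹ * φ g * h
    rw [hh, ← mul_assoc, ← mul_assoc, inv_mul_cancel, one_mul, inv_mul_cancel_right]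

end Equivalences

end BaseGaloisSystem

end Literature.AlgebraicGeometry.Frobenioids

end
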